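import Literature.NumberTheory.LFunctions.MatomakiRadziwillTaoT2OfVK
import Literature.NumberTheory.LFunctions.VinogradovZetaSumEstimate
import HarnessLib

/-!
# Matomäki–Radziwiłł–Tao 2015, Proposition A.3 and Theorem A.2 in restricted-Halász form — unconditionally

Topic `Literature/NumberTheory/LFunctions`.  Everything in this file is PROVED; no definitions, no named facts.

K. Matomäki, M. Radziwiłł, T. Tao, *An averaged form of Chowla's conjecture*, Algebra & Number Theory **9** (2015),
Appendix A (arXiv:1503.05121, §6) states Proposition A.3 (= Prop. 6.3) — the mean value
`∫_0^T |F(1+it)|² dt ≪ (T/(X/Q₁) + 1)((log Q₁)^{1/3}/P₁^{1/6-η} + e^{-M(f;X)} M(f;X) + (log X)^{-1/50})` of the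
`𝒮`-restricted polynomial `F(s) = ∑_{X ≤ n ≤ 2X, n ∈ 𝒮} f(n) n^{-s}` — and deduces Theorem A.2 (= Thm. 6.2) from it by
a Parseval bound.  The tree vendors both AS PRINTED as the named facts `MatomakiRadziwillTao2015_propA3`
(`MatomakiRadziwillTaoPropA3.lean`, middle term read as `(1 + M) e^{-M}`) and `MatomakiRadziwillTao2015_theoremA2`
(`MatomakiRadziwillTaoTheoremA2.lean`), and records in the former's module docstring ("Status of the named fact") why
neither is dischargeable from the printed proof: its pointwise step "`F(1+it) ≪ e^{-M} M` by Halász's theorem on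
`𝒯₀`" treats the restricted sum as an unrestricted one, and for restricted (sifted) sums Halász's theorem carries
`M e^{-M/2}` [cite: MatomakiRadziwill2020ShortIntervalsII, Lemma 5.3].

What the printed argument does establish — for completely multiplicative `f`, with the middle term
`K (1 + M) e^{-M/2}` — is the hypothesis schema `MRT2015.PropA3With (fun M => K (1 + M) e^{-M/2})`
(`MatomakiRadziwillTaoPropA3With.lean`), proved in `MatomakiRadziwillTaoT2OfVK.lean`
(`MRT2015.propA3With_exp_half_of_vk`) from any Vinogradov–Korobov zero-free region `HasVKZeroFreeRegion cVK TVK`.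
Since the tree now proves such a region outright (`VKZeta.exists_hasVKZeroFreeRegion`,
`VinogradovZetaSumEstimate.lean`: Vinogradov's mean value theorem, Ivić's Theorem 6.2, Landau's deduction), the
corrected Proposition A.3 and Theorem A.2 hold with NO hypothesis.  This file records the two closed statements:

* `MRT2015.propA3With_exp_half` — `∃ K ≥ 0, PropA3With (fun M => K (1 + M) e^{-M/2})`: for every `η ∈ (0, 1/6)`
  there are `C, X(η)` with `∫_0^T |F(1+it)|² dt ≤ C (T/(X/Q₁) + 1)((log Q₁)^{1/3}/P₁^{1/6-η} + K(1+M)e^{-M/2} + (log X)^{-1/50})`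
  for all `X > X(η)`, `√X ≤ X₀ ≤ X`, `T ≥ 0`, every interval system `I : SieveIntervalSystem η X₀` and every completely
  multiplicative `1`-bounded `f`, `M = M(f; X) = minPretentiousDistSq f X X`;
* `MRT2015.theoremA2With_exp_half` — `∃ K ≥ 0, TheoremA2With (fun M => K (1 + M) e^{-M/2})`: Theorem A.2 in the
  same form (`MRT2015.theoremA2With_of_propA3With`, the Parseval deduction of Appendix A).

These are the statements to use in place of `(h : MatomakiRadziwillTao2015_propA3)` /
`(h : MatomakiRadziwillTao2015_theoremA2)`; through `Tao2016_prop24_of_propA3With_exp_half`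
(`TaoLogElliottProp24OfPropA3With.lean`) they give Tao's logarithmically averaged two-point Chowla and Elliott
theorems, and through `MRT2015.A2With.theorem17With` Matomäki–Radziwiłł–Tao's Theorem 1.7 with rate `e^{-M/120}`.

## What is NOT here
* The printed middle term `(1 + M) e^{-M}` (or `e^{-M} M`), and general (not completely) multiplicative `f`: not
  established by any source known to this library (see the Status section of `MatomakiRadziwillTaoPropA3.lean`); an
  instance `PropA3With (fun M => K (1 + M)² e^{-M})`, which suffices for Theorem 1.7 as printed
  (`MRT2015.theorem17_of_propA3With_sq`), is the object of `HalaszRestrictedShort*.lean` (short-interval restricted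
  Halász theorem + Gallagher's lemma over the window `|t - t₁| ≤ (log X)^{1/16}`).
* The discharges `Tao2016_prop24_holds`, … themselves (they belong with their facts' files).

## References
* K. Matomäki, M. Radziwiłł, T. Tao, Algebra & Number Theory 9 (2015), 2167–2196; arXiv:1503.05121 §6: Theorem 6.2
  (= A.2), Proposition 6.3 (= A.3) and its proof (the ranges `𝒯₀, 𝒯₁, 𝒯₂`), Lemma 6.4 (= A.4).
  [cite: MatomakiRadziwillTao2015, Appendix A, Proposition A.3]
* K. Matomäki, M. Radziwiłł, *Multiplicative functions in short intervals II*, arXiv:2007.04290, Lemma 5.3(ii),(iv)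
  (Halász for sifted sums: `M e^{-M/2}`, the `1/2` removable only when `∑_{p ∈ 𝒫} 1/p = O(1)`).
  [cite: MatomakiRadziwill2020ShortIntervalsII, Lemma 5.3]
* A. Ivić, *The Riemann zeta-function* (1985), Theorem 6.2 and Lemma 6.3 (the zero-free region from Vinogradov's
  mean value theorem). [cite: Ivic1985, Theorem 6.2]

## Design choices
* No statement of the tree is changed and nothing is re-proved: the two theorems are the compositions
  `propA3With_exp_half_of_vk ∘ exists_hasVKZeroFreeRegion` and `theoremA2With_of_propA3With`.
* The constant `K ≥ 0` is the absolute constant of the window bound `integral_sq_restrDirichlet_window_le_of_vk`;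
  it is kept existential, as in `propA3With_exp_half_of_vk`.
-/

noncomputable section

namespace Literature.NumberTheory.LFunctions

namespace MRT2015

/-- **Matomäki–Radziwiłł–Tao 2015, Proposition A.3 in restricted-Halász form, unconditionally**: there is an
absolute `K ≥ 0` such that `MRT2015.PropA3With (fun M => K (1 + M) e^{-M/2})` holds — i.e. for every
`η ∈ (0, 1/6)` there are `C, X(η)` such that for all `X > X(η)`, `√X ≤ X₀ ≤ X`, `T ≥ 0`, every
`I : SieveIntervalSystem η X₀` and every completely multiplicative `f : ArithmeticFunction ℂ` with `|f| ≤ 1`,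
`∫_0^T |F(1+it)|² dt ≤ C (T/(X/Q₁) + 1) ((log Q₁)^{1/3}/P₁^{1/6-η} + K (1 + M) e^{-M/2} + (log X)^{-1/50})`,
`F = restrDirichlet f I X`, `M = minPretentiousDistSq f X X`.  This is Proposition A.3 with the middle term that
the printed argument (mean value theorem for `T ≥ X/2`; restricted Halász on the window `|t - t₁| ≤ (log X)^{1/16}`;
Lemma A.4 and Matomäki–Radziwiłł's Proposition 1 on `𝒯₂`) actually delivers for the `𝒮`-restricted polynomial,
now free of the Vinogradov–Korobov hypothesis (`VKZeta.exists_hasVKZeroFreeRegion`).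
[cite: MatomakiRadziwillTao2015, Appendix A, Proposition A.3] -/
theorem propA3With_exp_half :
    ∃ K : ℝ, 0 ≤ K ∧ PropA3With (fun M => K * (1 + M) * Real.exp (-M / 2)) := by
  obtain ⟨c, hc, hVK⟩ := VKZeta.exists_hasVKZeroFreeRegion
  exact propA3With_exp_half_of_vk hc hVK

/-- **Matomäki–Radziwiłł–Tao 2015, Theorem A.2 in restricted-Halász form, unconditionally**: there is an absolute
`K ≥ 0` such that `MRT2015.TheoremA2With (fun M => K (1 + M) e^{-M/2})` holds — for every `η ∈ (0, 1/6)` there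
are `C, X(η)` such that for all `X > X(η)`, `h ≥ 3`, `√X ≤ X₀ ≤ X`, every `I : SieveIntervalSystem η X₀` with
`Q₁ ≤ h` and every completely multiplicative `1`-bounded `f`,
`(1/X) ∫_X^{2X} |h⁻¹ ∑_{x ≤ n ≤ x+h, n ∈ 𝒮} f(n)|² dx ≤ C (K (1 + M) e^{-M/2} + (log h)^{1/3}/P₁^{1/6-η} + (log X)^{-1/50})`.
Proof: the Parseval deduction `theoremA2With_of_propA3With` applied to `propA3With_exp_half`.
[cite: MatomakiRadziwillTao2015, Appendix A, Theorem A.2] -/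
theorem theoremA2With_exp_half :
    ∃ K : ℝ, 0 ≤ K ∧ TheoremA2With (fun M => K * (1 + M) * Real.exp (-M / 2)) := by
  obtain ⟨K, hK, h⟩ := propA3With_exp_half
  exact ⟨K, hK, theoremA2With_of_propA3With (fun M _ => by positivity) h⟩

end MRT2015

end Literature.NumberTheory.LFunctions
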